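import Summits.ValiantsHypothesis.ValiantsHypothesis.Theorems.DefinabilityGapZeroPattern
import Summits.ValiantsHypothesis.ValiantsHypothesis.Theorems.DefinabilityGapPivotCertificate
import Summits.ValiantsHypothesis.ValiantsHypothesis.Theorems.DefinabilityGapSymmetry
import HarnessLib

/-!
# The ghost family at `m = 3`: a kernel instance of two-line independence

Route `DefinabilityGap`, residual crux `KIPlantedHitting` (item 23547), rung `R_K1.1`
(design girth). The *ghost family* at `m = 3` (`q = q(3) = 11`) is the union of the two full
parallel line classes `{(a, 0, 0) : a ∈ 𝔽₁₁}` and `{(a, 0, 1) : a ∈ 𝔽₁₁}` of the quadratic-curve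
design (the blocks `v = a` and `v = a + k²`), here together with one further curve `(1, 2, 3)`:
`23 = 2q + 1` coordinates of the KI-planted permanent map `G₃`. It is the standing counterexample
to *position-uniform* leading-monomial certificates (`Σ_{c ∈ ℓ} 1_{D(c)} = Σ_{c ∈ ℓ'} 1_{D(c)}`
for every diagonal pattern `D`), so no lex / plain ranking certificate
(`DefinabilityGapLexCertificate`) can certify it.

This file certifies it **in the kernel** through the zero-pattern certificate
`kiPer_algebraicIndependent_of_zeroPattern` (specialise the two seed variables
`W = {(6, 2), (7, 2)}` to `0`, then rank): the first kernel-checked instance of independence of a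
family containing two whole parallel classes, i.e. of the `2q + 1` girth target of `K1Clause 1`
at a concrete `m`. The combinatorial side conditions (liveness, pivot maximality, height
comparisons over the `23 × 23 × 9` incidences) are discharged by `decide` **in the kernel**
(no `native_decide`, no extra axioms) on an explicit `ℕ`-model of the cells (`mcell`), transported
to `cellEmb 3` by the coordinate formulae `cellEmb_fst_val` / `cellEmb_snd_val` and
`qOf_three : q(3) = 11`; the algebra (`AlgebraicIndependent` over `ℂ`) is entirely the landed rung
`DefinabilityGapZeroPattern`. The certificate data (pivots, heights, `W`) were found by the
route's instrument (peeling search) and are checked here, not trusted.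
-/

noncomputable section

open MvPolynomial
open Literature.Computability.AlgebraicComplexity Literature.Computability.MetaComplexity
open Summit.ValiantsHypothesis.ValiantsHypothesis.Theorems.DefinabilityGapAffineRung
open Summit.ValiantsHypothesis.ValiantsHypothesis.Theorems.DefinabilityGapZeroPattern
open Summit.ValiantsHypothesis.ValiantsHypothesis.Theorems.DefinabilityGapPivotCertificate
  (cellEmb_fst)
open Summit.ValiantsHypothesis.ValiantsHypothesis.Theorems.DefinabilityGapSymmetry
  (quadDesign_apply')

namespace Summit.ValiantsHypothesis.ValiantsHypothesis.Theorems.DefinabilityGapGhostThree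

/-! ## Coordinates of the cells (all `m`) -/

/-- The abscissa of the cell at position `p = (i, j)` of block `c` is `j + m i`. [this file] -/
theorem cellEmb_fst_val (m : ℕ) (c : Fin 3 → Fin (qOf m)) (p : Fin m × Fin m) :
    ((cellEmb m c p).1 : ℕ) = p.2 + m * p.1 := by
  rw [cellEmb_fst]
  rfl

/-- The ordinate of the cell at position `p = (i, j)` of block `c = (c₀, c₁, c₂)` is
`c₀ + c₁ k + c₂ k² (mod q)` with `k = j + m i`. [this file] -/
theorem cellEmb_snd_val (m : ℕ) (c : Fin 3 → Fin (qOf m)) (p : Fin m × Fin m) :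
    ((cellEmb m c p).2 : ℕ) =
      ((c 0 : ℕ) + (c 1 : ℕ) * (p.2 + m * p.1) + (c 2 : ℕ) * (p.2 + m * p.1) ^ 2) % qOf m := by
  have h1 : cellEmb m c p = quadDesign m c (permPad (sq_le_qOf m) p) := rfl
  rw [show ((p.2 : ℕ) + m * (p.1 : ℕ) : ℕ) = ((permPad (sq_le_qOf m) p : Fin (qOf m)) : ℕ)
      from rfl, h1, quadDesign_apply']
  dsimp only
  generalize permPad (sq_le_qOf m) p = k
  -- `finEquiv` is the residue map in both directions (local copies of one-line Mathlib-level facts)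
  have hfe : ∀ (q : ℕ) [NeZero q] (x : Fin q), ZMod.finEquiv q x = ((x : ℕ) : ZMod q) := by
    intro q _ x
    cases q with
    | zero => exact absurd rfl (NeZero.ne 0)
    | succ n => exact (ZMod.natCast_zmod_val (n := n + 1) x).symm
  have hvs : ∀ (q : ℕ) [NeZero q] (y : ZMod q),
      (((ZMod.finEquiv q).symm y : Fin q) : ℕ) = y.val := by
    intro q _ y
    cases q with
    | zero => exact absurd rfl (NeZero.ne 0)
    | succ n => rfl
  rw [hvs, Polynomial.ofFn_eq_sum_monomial, Polynomial.eval_finsetSum]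
  simp only [Polynomial.eval_monomial, Fin.sum_univ_three, hfe]
  norm_num
  rw [← ZMod.val_natCast]
  congr 1
  push_cast
  ring

/-- `q(3) = 11` (the least prime `≥ 10`). [this file] -/
theorem qOf_three : qOf 3 = 11 := by
  show leastPrimeGe (3 * 3 + 1) = 11
  unfold leastPrimeGe
  rw [Nat.find_eq_iff]
  refine ⟨⟨by norm_num, by norm_num⟩, fun n hn h => ?_⟩
  obtain ⟨h1, h2⟩ := h
  interval_cases n
  exact absurd h2 (by norm_num)

/-! ## The explicit `ℕ`-model of the certificate -/

/-- Curve data `(c₀, c₁, c₂) ∈ ℕ³` (entries `< 11`). [this file] -/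
abbrev Curve := ℕ × ℕ × ℕ

/-- The 23 curves `(c₀, c₁, c₂)` of the ghost family, listed in peeling order (first peeled first):
the two full parallel classes `{(a, 0, 0)}`, `{(a, 0, 1)}` (`a ∈ 𝔽₁₁`) and the extra curve
`(1, 2, 3)`. [this file] -/
def ghostCurves : List Curve :=
  [(9, 0, 1), (10, 0, 1), (7, 0, 0), (3, 0, 0), (4, 0, 0), (0, 0, 0), (1, 0, 0), (8, 0, 0),
   (9, 0, 0), (10, 0, 0), (4, 0, 1), (5, 0, 1), (0, 0, 1), (1, 0, 1), (2, 0, 1), (8, 0, 1),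
   (6, 0, 1), (7, 0, 1), (3, 0, 1), (6, 0, 0), (5, 0, 0), (2, 0, 0), (1, 2, 3)]

/-- The pivot position `(row, column)` of each curve of the ghost family (found by the instrument's
peeling search; default `(0, 0)` off the list). [this file] -/
def pivotTab : List (Curve × (Fin 3 × Fin 3)) :=
  [((9, 0, 1), (0, 2)), ((10, 0, 1), (1, 2)), ((7, 0, 0), (1, 0)),
   ((3, 0, 0), (0, 2)), ((4, 0, 0), (1, 1)), ((0, 0, 0), (0, 1)),
   ((1, 0, 0), (1, 2)), ((8, 0, 0), (1, 0)), ((9, 0, 0), (0, 0)),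
   ((10, 0, 0), (0, 0)), ((4, 0, 1), (0, 0)), ((5, 0, 1), (0, 2)),
   ((0, 0, 1), (0, 0)), ((1, 0, 1), (1, 0)), ((2, 0, 1), (0, 1)),
   ((8, 0, 1), (0, 0)), ((6, 0, 1), (0, 1)), ((7, 0, 1), (0, 0)),
   ((3, 0, 1), (0, 0)), ((6, 0, 0), (0, 0)), ((5, 0, 0), (0, 0)),
   ((2, 0, 0), (0, 0)), ((1, 2, 3), (0, 0))]

/-- The height table of the 121 cells `(k, v) ∈ 𝔽₁₁ × 𝔽₁₁`, entry `11 k + v`: a permutation of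
`0 … 120` placing the 23 pivot cells on top in reverse peeling order. [this file] -/
def rankTab : List ℕ :=
  [108, 98, 99, 102, 110, 100, 101, 103, 105, 112, 111,
   115, 0, 1, 106, 2, 3, 4, 104, 5, 6, 7,
   8, 9, 120, 117, 10, 11, 12, 13, 14, 109, 15,
   16, 17, 18, 19, 20, 21, 22, 118, 113, 23, 107,
   24, 25, 26, 27, 116, 28, 29, 30, 31, 32, 33,
   34, 114, 119, 35, 36, 37, 38, 39, 40, 41, 42,
   43, 44, 45, 46, 47, 48, 49, 50, 51, 52, 53,
   54, 55, 56, 57, 58, 59, 60, 61, 62, 63, 64,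
   65, 66, 67, 68, 69, 70, 71, 72, 73, 74, 75,
   76, 77, 78, 79, 80, 81, 82, 83, 84, 85, 86,
   87, 88, 89, 90, 91, 92, 93, 94, 95, 96, 97]

/-- The pivot position of a curve (model side). [this file] -/
def p0m (t : Curve) : Fin 3 × Fin 3 := (pivotTab.lookup t).getD (0, 0)

/-- The two specialised seed variables `W = {(6, 2), (7, 2)}` (cells `(k, v)`; the gadget found
by the instrument: row `2`, columns `0, 1` of the block of `(2, 0, 0)`). [this file] -/
def mW : List (ℕ × ℕ) := [(6, 2), (7, 2)]

/-- Model height of a cell `(k, v)`: the rank-table entry `11 k + v`. [this file] -/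
def mH (x : ℕ × ℕ) : ℕ := rankTab.getD (11 * x.1 + x.2) 0

/-- Model cell of curve `t` at position `p = (i, j)`: `(k, (t₀ + t₁ k + t₂ k²) mod 11)`,
`k = j + 3 i`. [this file] -/
def mcell (t : Curve) (p : Fin 3 × Fin 3) : ℕ × ℕ :=
  ((p.2 : ℕ) + 3 * (p.1 : ℕ),
    (t.1 + t.2.1 * ((p.2 : ℕ) + 3 * (p.1 : ℕ)) + t.2.2 * ((p.2 : ℕ) + 3 * (p.1 : ℕ)) ^ 2) % 11)

/-- Model liveness of position `p` of curve `t` after zeroing `W`: some transversal through `p`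
avoids `W`, written with the three (distinct) rows `a, b, c` used in columns `0, 1, 2` (a `Bool`,
so that the finite checks below run by `decide` in the kernel). [this file] -/
def mliveB (t : Curve) (p : Fin 3 × Fin 3) : Bool :=
  decide (∃ a b c : Fin 3, a ≠ b ∧ a ≠ c ∧ b ≠ c ∧ mcell t (a, 0) ∉ mW ∧ mcell t (b, 1) ∉ mW ∧
    mcell t (c, 2) ∉ mW ∧ ![a, b, c] p.2 = p.1)

/-! ## The finite checks (by `decide` in the kernel) -/

/-- Every curve entry is reduced `mod 11`. [this file] -/
theorem ghostCurves_lt : ∀ t ∈ ghostCurves, t.1 < 11 ∧ t.2.1 < 11 ∧ t.2.2 < 11 := by decide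

/-- The zero cells are reduced `mod 11`. [this file] -/
theorem mW_lt : ∀ x ∈ mW, x.1 < 11 ∧ x.2 < 11 := by decide

/-- (live) every pivot is live after zeroing `W`. [this file] -/
theorem model_live : ∀ t ∈ ghostCurves, mliveB t (p0m t) = true := by decide +kernel

/-- (top) the pivot is the highest live cell of its own block. [this file] -/
theorem model_top : ∀ t ∈ ghostCurves, ∀ p : Fin 3 × Fin 3, p ≠ p0m t → mliveB t p = true →
    mH (mcell t p) < mH (mcell t (p0m t)) := by
  decide +kernel

/-- (tri) a pivot cell occurring live in another block lies below that block's pivot. [this file] -/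
theorem model_tri : ∀ t ∈ ghostCurves, ∀ t' ∈ ghostCurves, t' ≠ t → ∀ p : Fin 3 × Fin 3,
    mcell t' p = mcell t (p0m t) → mliveB t' p = true →
    mH (mcell t (p0m t)) < mH (mcell t' (p0m t')) := by
  decide +kernel

/-- The rank table has `121` entries. [this file] -/
theorem rankTab_length : rankTab.length = 121 := by decide +kernel

/-- The rank table has no repeated entry. [this file] -/
theorem rankTab_nodup : rankTab.Nodup := by decide +kernel

/-- The model height is injective on `[0, 11)²`. [this file] -/
theorem mH_inj {a b c d : ℕ} (ha : a < 11) (hb : b < 11) (hc : c < 11) (hd : d < 11)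
    (h : mH (a, b) = mH (c, d)) : a = c ∧ b = d := by
  have hi : 11 * a + b < rankTab.length := by rw [rankTab_length]; omega
  have hj : 11 * c + d < rankTab.length := by rw [rankTab_length]; omega
  unfold mH at h
  dsimp only at h
  rw [List.getD_eq_getElem rankTab 0 hi, List.getD_eq_getElem rankTab 0 hj] at h
  have hij := (List.Nodup.getElem_inj_iff rankTab_nodup).mp h
  omega

/-! ## Transport to the design -/

/-- `n mod q(3)` as an element of `Fin q(3)`. [this file] -/
def natQ (n : ℕ) : Fin (qOf 3) := ⟨n % qOf 3, Nat.mod_lt _ (qOf_spec 3).2.pos⟩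

/-- `(natQ n : ℕ) = n` for `n < 11`. [this file] -/
theorem natQ_val {n : ℕ} (hn : n < 11) : (natQ n : ℕ) = n := by
  show n % qOf 3 = n
  rw [qOf_three]
  exact Nat.mod_eq_of_lt hn

/-- The curve of the design named by the data `t`. [this file] -/
def curveOf (t : Curve) : Fin 3 → Fin (qOf 3)
  | ⟨0, _⟩ => natQ t.1
  | ⟨1, _⟩ => natQ t.2.1
  | _ => natQ t.2.2

/-- The seed cell named by the data `x`. [this file] -/
def cellOf (x : ℕ × ℕ) : Fin (qOf 3) × Fin (qOf 3) := (natQ x.1, natQ x.2)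

/-- The pair of coordinates of a seed cell, as naturals. [this file] -/
def valPair (x : Fin (qOf 3) × Fin (qOf 3)) : ℕ × ℕ := ((x.1 : ℕ), (x.2 : ℕ))

/-- The data triple of a curve. [this file] -/
def tripleOf (c : Fin 3 → Fin (qOf 3)) : Curve := ((c 0 : ℕ), (c 1 : ℕ), (c 2 : ℕ))

/-- **The ghost family** at `m = 3`: both parallel classes `{(a,0,0)}`, `{(a,0,1)}` and `(1,2,3)`.
[this file] -/
def ghostFamily : Finset (Fin 3 → Fin (qOf 3)) := ghostCurves.toFinset.image curveOf

/-- The zero set `W = {(6, 2), (7, 2)}` in the seed universe. [this file] -/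
def ghostZeros : Finset (Fin (qOf 3) × Fin (qOf 3)) := (mW.map cellOf).toFinset

/-- The height of a seed cell (rank table). [this file] -/
def height (x : Fin (qOf 3) × Fin (qOf 3)) : ℕ := mH (valPair x)

/-- The pivot position of a curve of the design. [this file] -/
def pivotOf (c : Fin 3 → Fin (qOf 3)) : Fin 3 × Fin 3 := p0m (tripleOf c)

/-- `valPair` is injective. [this file] -/
theorem valPair_injective : Function.Injective valPair := by
  intro x y h
  simp only [valPair, Prod.mk.injEq] at h
  exact Prod.ext (Fin.ext h.1) (Fin.ext h.2)

/-- Round trip on reduced data. [this file] -/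
theorem tripleOf_curveOf {t : Curve} (ht : t.1 < 11 ∧ t.2.1 < 11 ∧ t.2.2 < 11) :
    tripleOf (curveOf t) = t := by
  obtain ⟨a, b, c⟩ := t
  show (((natQ a : Fin (qOf 3)) : ℕ), ((natQ b : Fin (qOf 3)) : ℕ), ((natQ c : Fin (qOf 3)) : ℕ)) =
    (a, b, c)
  rw [natQ_val ht.1, natQ_val ht.2.1, natQ_val ht.2.2]

/-- Round trip on reduced cells. [this file] -/
theorem valPair_cellOf {x : ℕ × ℕ} (hx : x.1 < 11 ∧ x.2 < 11) : valPair (cellOf x) = x := by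
  obtain ⟨a, b⟩ := x
  show (((natQ a : Fin (qOf 3)) : ℕ), ((natQ b : Fin (qOf 3)) : ℕ)) = (a, b)
  rw [natQ_val hx.1, natQ_val hx.2]

/-- The pivot of a listed curve is its model pivot. [this file] -/
theorem pivotOf_curveOf {t : Curve} (ht : t.1 < 11 ∧ t.2.1 < 11 ∧ t.2.2 < 11) :
    pivotOf (curveOf t) = p0m t := by
  rw [pivotOf, tripleOf_curveOf ht]

/-- **Cells of a listed curve are computed by the model.** [this file] -/
theorem valPair_cellEmb (t : Curve) (ht : t.1 < 11 ∧ t.2.1 < 11 ∧ t.2.2 < 11) (p : Fin 3 × Fin 3) :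
    valPair (cellEmb 3 (curveOf t) p) = mcell t p := by
  have h0 : ((curveOf t 0 : Fin (qOf 3)) : ℕ) = t.1 := natQ_val ht.1
  have h1 : ((curveOf t 1 : Fin (qOf 3)) : ℕ) = t.2.1 := natQ_val ht.2.1
  have h2 : ((curveOf t 2 : Fin (qOf 3)) : ℕ) = t.2.2 := natQ_val ht.2.2
  refine Prod.ext ?_ ?_
  · exact cellEmb_fst_val 3 (curveOf t) p
  · show ((cellEmb 3 (curveOf t) p).2 : ℕ) = _
    rw [cellEmb_snd_val, h0, h1, h2, qOf_three]
    rfl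

/-- Membership in `W` is computed by the model. [this file] -/
theorem mem_ghostZeros_iff (y : Fin (qOf 3) × Fin (qOf 3)) : y ∈ ghostZeros ↔ valPair y ∈ mW := by
  simp only [ghostZeros, List.mem_toFinset, List.mem_map]
  constructor
  · rintro ⟨x, hx, rfl⟩
    rwa [valPair_cellOf (mW_lt x hx)]
  · intro h
    exact ⟨valPair y, h, valPair_injective (by rw [valPair_cellOf (mW_lt _ h)])⟩

/-- The values of a permutation of `Fin 3` as a vector. [this file] -/
theorem vec_perm_apply (ρ : Equiv.Perm (Fin 3)) (j : Fin 3) : ![ρ 0, ρ 1, ρ 2] j = ρ j := by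
  fin_cases j <;> rfl

/-- A vector of three distinct entries of `Fin 3` is injective. [this file] -/
theorem vec_injective {a b c : Fin 3} (hab : a ≠ b) (hac : a ≠ c) (hbc : b ≠ c) :
    Function.Injective ![a, b, c] := by
  intro i j h
  fin_cases i <;> fin_cases j <;>
    first
    | rfl
    | exact absurd h hab
    | exact absurd h hac
    | exact absurd h hbc
    | exact absurd h.symm hab
    | exact absurd h.symm hac
    | exact absurd h.symm hbc

/-- Liveness is computed by the model. [this file] -/
theorem live_iff (t : Curve) (ht : t.1 < 11 ∧ t.2.1 < 11 ∧ t.2.2 < 11) (p : Fin 3 × Fin 3) :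
    (∃ ρ : Equiv.Perm (Fin 3), (∀ i, cellEmb 3 (curveOf t) (ρ i, i) ∉ ghostZeros) ∧ ρ p.2 = p.1) ↔
      mliveB t p = true := by
  rw [mliveB, decide_eq_true_iff]
  simp only [mem_ghostZeros_iff, valPair_cellEmb t ht]
  constructor
  · rintro ⟨ρ, hW, hp⟩
    refine ⟨ρ 0, ρ 1, ρ 2, fun h => absurd (ρ.injective h) (by decide),
      fun h => absurd (ρ.injective h) (by decide), fun h => absurd (ρ.injective h) (by decide),
      hW 0, hW 1, hW 2, ?_⟩
    rw [vec_perm_apply, hp]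
  · rintro ⟨a, b, c, hab, hac, hbc, ha, hb, hc, hp⟩
    refine ⟨Equiv.ofBijective _ (Finite.injective_iff_bijective.mp (vec_injective hab hac hbc)),
      ?_, hp⟩
    intro i
    fin_cases i
    · exact ha
    · exact hb
    · exact hc

/-- Heights are computed by the model. [this file] -/
theorem height_cellEmb (t : Curve) (ht : t.1 < 11 ∧ t.2.1 < 11 ∧ t.2.2 < 11) (p : Fin 3 × Fin 3) :
    height (cellEmb 3 (curveOf t) p) = mH (mcell t p) := by
  rw [height, valPair_cellEmb t ht]

/-- The height is injective on the whole seed universe. [this file] -/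
theorem height_injective : Function.Injective height := by
  intro x y hxy
  have hq := qOf_three
  have hx1 : (x.1 : ℕ) < 11 := by have := x.1.isLt; omega
  have hx2 : (x.2 : ℕ) < 11 := by have := x.2.isLt; omega
  have hy1 : (y.1 : ℕ) < 11 := by have := y.1.isLt; omega
  have hy2 : (y.2 : ℕ) < 11 := by have := y.2.isLt; omega
  have key := mH_inj hx1 hx2 hy1 hy2 hxy
  exact valPair_injective (Prod.ext key.1 key.2)

/-- Members of the ghost family are listed curves. [this file] -/
theorem exists_of_mem_ghostFamily {c : Fin 3 → Fin (qOf 3)} (hc : c ∈ ghostFamily) :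
    ∃ t ∈ ghostCurves, curveOf t = c := by
  simpa only [ghostFamily, Finset.mem_image, List.mem_toFinset] using hc

/-- The ghost family has `23 = 2 q(3) + 1` members. [this file] -/
theorem ghostFamily_card : ghostFamily.card = 2 * qOf 3 + 1 := by
  have hc : ghostFamily.card = 23 := by
    rw [ghostFamily, Finset.card_image_of_injOn]
    · decide
    · intro t ht t' ht' h
      have h1 := congrArg tripleOf h
      rwa [tripleOf_curveOf (ghostCurves_lt t (by simpa using ht)),
        tripleOf_curveOf (ghostCurves_lt t' (by simpa using ht'))] at h1
  have hq := qOf_three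
  omega

/-! ## The theorem -/

/-- **The ghost family at `m = 3` is algebraically independent**: the `23 = 2q + 1` permanents
`per₃(y|S_c)`, `c ∈ {(a,0,0)} ∪ {(a,0,1)} ∪ {(1,2,3)}`, planted along the quadratic-curve design
over `𝔽₁₁`, are algebraically independent over `ℂ` — certified by the zero-pattern certificate with
`W = {(6,2),(7,2)}`.  First kernel instance of the `2q + 1` girth target on a family containing two
full parallel classes (where every plain ranking certificate provably fails). [this file] -/
theorem ghostFamily_algebraicIndependent :
    AlgebraicIndependent ℂ (fun c : ghostFamily => kiPer 3 (c : Fin 3 → Fin (qOf 3))) := by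
  refine kiPer_algebraicIndependent_of_zeroPattern 3 ghostFamily ghostZeros height height_injective
    pivotOf ?_ ?_ ?_
  · intro c hc
    obtain ⟨t, ht, rfl⟩ := exists_of_mem_ghostFamily hc
    have htl := ghostCurves_lt t ht
    rw [pivotOf_curveOf htl, live_iff t htl]
    exact model_live t ht
  · intro c hc p hp hlive
    obtain ⟨t, ht, rfl⟩ := exists_of_mem_ghostFamily hc
    have htl := ghostCurves_lt t ht
    rw [pivotOf_curveOf htl] at hp ⊢
    rw [live_iff t htl] at hlive
    rw [height_cellEmb t htl, height_cellEmb t htl]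
    exact model_top t ht p hp hlive
  · intro c hc c' hc' hne p heq hlive
    obtain ⟨t, ht, rfl⟩ := exists_of_mem_ghostFamily hc
    obtain ⟨t', ht', rfl⟩ := exists_of_mem_ghostFamily hc'
    have htl := ghostCurves_lt t ht
    have htl' := ghostCurves_lt t' ht'
    have hne' : t' ≠ t := fun h => hne (by rw [h])
    rw [pivotOf_curveOf htl] at heq ⊢
    rw [pivotOf_curveOf htl']
    rw [live_iff t' htl'] at hlive
    have heq' : mcell t' p = mcell t (p0m t) := by
      rw [← valPair_cellEmb t' htl', ← valPair_cellEmb t htl, heq]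
    rw [height_cellEmb t htl, height_cellEmb t' htl']
    exact model_tri t ht t' ht' hne' p heq' hlive

end Summit.ValiantsHypothesis.ValiantsHypothesis.Theorems.DefinabilityGapGhostThree
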